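import Literature.NumberTheory.Transcendental.RoySmallValueEstimatesAbsHeightProofs
import Mathlib.NumberTheory.Height.MvPolynomial
import Mathlib.NumberTheory.Height.NumberField
import Mathlib.LinearAlgebra.Matrix.NonsingularInverse
import Mathlib.LinearAlgebra.Matrix.Rank
import HarnessLib

/-!
# Stub plan `CycleAPIAt3`, P3′ lemmas (II): Cramer vectors of small height (towards `stub_satelliteHeight`)

Crux `stmt-Schanuel-6117` (`Summit.Schanuel.Schanuel.Theses.DiophantineDichotomy.ApproximationProperty`),
route `DiophantineDichotomy`, line `orbit-interpolation-determinant`, registered stub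
`stub_satelliteHeight : SatelliteHeight` (vocabulary `…CycleAPIAt3Defs.lean`). The interpolation
of the degree-`ν` part of the ideal of a Galois orbit by small rational forms (file
`…SatelliteHeightOrbitForms.lean`) solves, over the compositum `L` of the conjugate fields, linear
systems whose rows are Veronese vectors of conjugate points. This file is the HEIGHT THEORY of
such solutions (Bombieri–Vaaler / Bombieri–Gubler §2.8–2.9 in the elementary Cramer form that
suffices here), for an arbitrary number field `L`:

* `exists_cramer_vector` (registered sub-goal): if the square block `(x_a(e c))_{a,c}` of a
  family of rows `x_a ∈ L^ι` is invertible and `j` is a further column, the kernel of the rows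
  contains a vector `w` with `w_j ≠ 0`, vanishing off `{j} ∪ e(α)`, and
  **`h_L(w) ≤ ∑_a h_L(x_a) + [L:ℚ] · #α · log #ι`** — its entries are maximal minors, i.e. the
  image of the tensor `⊗_a x_a` (of height `∑ h(x_a)`, Mathlib `Height.logHeight_fun_prod_eq`)
  under a linear map with entries in `{0, ±1}` (Mathlib `Height.logHeight_linearMap_apply_le`);
* `SatelliteHeightCramer.exists_isUnit_submatrix`: a matrix with independent columns has an
  invertible square block of rows (row rank = column rank);
* `SatelliteHeightCramer.logHeight_veronese_le`: `h_L((x^k)_{|k| = ν}) ≤ ν h_L(x)`;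
* `SatelliteHeightCramer.logHeight_eq_zero_of_sign`: a tuple with entries in `{0, ±1}` has
  height `0`.

No definitions. Sources: BombieriGubler2006 §1.5 (Lemma 1.5.2: `h_L = [L:K] h_K`), §2.8–2.9
(heights of matrices, minors and solutions of linear systems); folklore linear algebra.
-/

noncomputable section

-- `Summit.Schanuel.Schanuel.…` is the mandated summit/sub-problem namespace (single-conjunct summit), hence:
set_option linter.dupNamespace false

namespace Summit.Schanuel.Schanuel.Cruxes.ApproximationProperty.OrbitInterpolationDeterminant

open scoped BigOperators Matrix

namespace SatelliteHeightCramer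

variable {L : Type} [Field L]

/-! ## Tuples with entries in `{0, ±1}` -/

/-- A tuple of a number field with all entries in `{0, 1, −1}` has logarithmic height `0`
(it is the base change of a primitive integer vector of sup-norm `1`). [folklore] -/
theorem logHeight_eq_zero_of_sign [NumberField L] {κ : Type} [Fintype κ] (B : κ → L)
    (hB : ∀ k, B k = 0 ∨ B k = 1 ∨ B k = -1) : Height.logHeight B = 0 := by
  classical
  by_cases h0 : B = 0
  · rw [h0, Height.logHeight_zero]
  obtain ⟨k₀, hk₀⟩ := Function.ne_iff.mp h0
  have hm1 : (-1 : L) ≠ 1 := by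
    intro h
    have h2 : (2 : L) = 0 := by linear_combination -h
    exact two_ne_zero h2
  set Z : κ → ℤ := fun k => if B k = 1 then 1 else if B k = -1 then -1 else 0 with hZ_def
  have hZB : ∀ k, ((Z k : ℚ) : L) = B k := fun k => by
    rcases hB k with h | h | h <;> simp [Z, h, hm1]
  have hZk₀ : Z k₀ = 1 ∨ Z k₀ = -1 := by
    rcases hB k₀ with h | h | h
    · exact absurd h hk₀
    · left; simp [Z, h]
    · right; simp [Z, h, hm1]
  have habs : ∀ k, |Z k| ≤ 1 := fun k => by
    simp only [Z]; split_ifs <;> simp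
  have habs₀ : |Z k₀| = 1 := by rcases hZk₀ with h | h <;> simp [h]
  haveI : Nonempty κ := ⟨k₀⟩
  have hgcd : Finset.univ.gcd Z = 1 := by
    have hdvd : Finset.univ.gcd Z ∣ Z k₀ := Finset.gcd_dvd (Finset.mem_univ _)
    have hunit : IsUnit (Finset.univ.gcd Z) := by
      rcases hZk₀ with h | h
      · exact isUnit_of_dvd_one (h ▸ hdvd)
      · rw [h] at hdvd; exact isUnit_of_dvd_unit hdvd isUnit_one.neg
    rw [← Finset.normalize_gcd]
    exact normalize_eq_one.mpr hunit
  have hQ : Height.logHeight ((Int.cast : ℤ → ℚ) ∘ Z) = 0 := by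
    rw [Rat.logHeight_eq_max_abs_of_gcd_eq_one hgcd]
    have hsup : (⨆ i, |Z i|) = 1 := by
      refine le_antisymm (ciSup_le habs) ?_
      rw [← habs₀]
      exact le_ciSup (Finite.bddAbove_range fun i => |Z i|) k₀
    rw [hsup]; simp
  have hL := Literature.NumberTheory.Transcendental.NguyenRoy.logHeight_comp_div_finrank
    (algebraMap ℚ L) ((Int.cast : ℤ → ℚ) ∘ Z)
  rw [hQ, zero_div, div_eq_zero_iff] at hL
  have hfin : (Module.finrank ℚ L : ℝ) ≠ 0 := by exact_mod_cast Module.finrank_pos.ne'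
  have hBZ : B = fun k => algebraMap ℚ L (((Int.cast : ℤ → ℚ) ∘ Z) k) := funext fun k => by
    simp only [Function.comp_apply, eq_ratCast]; exact (hZB k).symm
  rw [hBZ]
  exact hL.resolve_right hfin

/-! ## Determinants of column-selections of a family of rows, over the tensor of the rows -/

/-- `det (x_a(col c))_{a,c} = ∑_k (∑_π [k = col ∘ π⁻¹] sign π) ∏_a x_a(k_a)`: a determinant whose
columns are selected from the rows `x_a` is an integer combination of the entries of the tensor
`⊗_a x_a`. [folklore] -/
theorem det_colSelect_eq_sum {α ι : Type} [Fintype α] [DecidableEq α] [Fintype ι] [DecidableEq ι]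
    (x : α → ι → L) (col : α → ι) :
    (Matrix.of fun a c => x a (col c)).det =
      ∑ k : α → ι, (∑ π : Equiv.Perm α,
        (if k = col ∘ π.symm then ((Equiv.Perm.sign π : ℤ) : L) else 0)) * ∏ a, x a (k a) := by
  rw [Matrix.det_apply']
  have h1 : ∀ π : Equiv.Perm α,
      (∏ i, (Matrix.of fun a c => x a (col c)) (π i) i) = ∏ a, x a ((col ∘ π.symm) a) := fun π =>
    Fintype.prod_equiv π _ _ fun i => by simp
  simp_rw [h1]
  symm
  calc ∑ k : α → ι, (∑ π : Equiv.Perm α,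
        (if k = col ∘ π.symm then ((Equiv.Perm.sign π : ℤ) : L) else 0)) * ∏ a, x a (k a)
      = ∑ k : α → ι, ∑ π : Equiv.Perm α,
          (if k = col ∘ π.symm then ((Equiv.Perm.sign π : ℤ) : L) else 0) * ∏ a, x a (k a) := by
        simp_rw [Finset.sum_mul]
    _ = ∑ π : Equiv.Perm α, ∑ k : α → ι,
          (if k = col ∘ π.symm then ((Equiv.Perm.sign π : ℤ) : L) else 0) * ∏ a, x a (k a) :=
        Finset.sum_comm
    _ = ∑ π : Equiv.Perm α, ((Equiv.Perm.sign π : ℤ) : L) * ∏ a, x a ((col ∘ π.symm) a) := by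
        refine Finset.sum_congr rfl fun π _ => ?_
        simp_rw [ite_mul, zero_mul]
        rw [Finset.sum_ite_eq']
        simp

/-- For an INJECTIVE column selection the coefficients above lie in `{0, ±1}` (at most one
permutation contributes). [folklore] -/
theorem sum_perm_ite_sign {α ι : Type} [Fintype α] [DecidableEq α] [DecidableEq ι]
    {col : α → ι} (hcol : Function.Injective col) (k : α → ι) :
    (∑ π : Equiv.Perm α, (if k = col ∘ π.symm then ((Equiv.Perm.sign π : ℤ) : L) else 0)) = 0 ∨
    (∑ π : Equiv.Perm α, (if k = col ∘ π.symm then ((Equiv.Perm.sign π : ℤ) : L) else 0)) = 1 ∨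
    (∑ π : Equiv.Perm α, (if k = col ∘ π.symm then ((Equiv.Perm.sign π : ℤ) : L) else 0)) = -1 := by
  by_cases h : ∃ π : Equiv.Perm α, k = col ∘ π.symm
  · obtain ⟨π₀, hπ₀⟩ := h
    have huniq : ∀ π : Equiv.Perm α, k = col ∘ π.symm → π = π₀ := fun π hπ => by
      have h1 : π.symm = π₀.symm :=
        Equiv.ext fun a => hcol (congrFun (hπ.symm.trans hπ₀) a)
      rw [← Equiv.symm_symm π, h1, Equiv.symm_symm]
    rw [Finset.sum_eq_single π₀ (fun π _ hne => if_neg fun hk => hne (huniq π hk))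
      (fun h => absurd (Finset.mem_univ _) h), if_pos hπ₀]
    rcases Int.units_eq_one_or (Equiv.Perm.sign π₀) with h1 | h1
    · right; left; rw [h1]; simp
    · right; right; rw [h1]; simp
  · left
    push Not at h
    exact Finset.sum_eq_zero fun π _ => if_neg (h π)

end SatelliteHeightCramer

open SatelliteHeightCramer in
/-- **Registered sub-goal `exists_cramer_vector`** (aux for `stub_satelliteHeight`): Cramer's rule
with heights. Let `x_a ∈ L^ι` (`a ∈ α`) be rows over a number field `L`, `e : α ↪ ι` a choice of
columns with `det (x_a(e c)) ≠ 0`, and `j ∉ e(α)`. Then some `w ∈ L^ι` has `w_j ≠ 0`, `w_i = 0`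
for `i ∉ e(α) ∪ {j}`, `∑_i x_a(i) w_i = 0` for every `a`, and
`h_L(w) ≤ ∑_a h_L(x_a) + #α · log #ι · [L:ℚ]` (entries of `w` = maximal minors = a
`{0, ±1}`-linear image of the tensor `⊗ x_a`). [cite: BombieriGubler2006, §2.8–2.9 (pp. 80–83)] -/
theorem exists_cramer_vector : ∀ (L : Type) [Field L] [NumberField L] (ι α : Type) [Fintype ι] [DecidableEq ι] [Fintype α] [DecidableEq α] (x : α → ι → L) (e : α ↪ ι) (j : ι), j ∉ Set.range e → IsUnit (Matrix.of fun a c => x a (e c)).det → ∃ w : ι → L, w j ≠ 0 ∧ (∀ i, i ∉ Set.range e → i ≠ j → w i = 0) ∧ (∀ a, ∑ i, x a i * w i = 0) ∧ Height.logHeight w ≤ ∑ a, Height.logHeight (x a) + Fintype.card α * Real.log (Fintype.card ι) * Module.finrank ℚ L := by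
  intro L _ _ ι α _ _ _ _ x e j hj hM
  classical
  set M : Matrix α α L := Matrix.of fun a c => x a (e c) with hM_def
  set y : α → L := fun a => x a j with hy_def
  set z : α → L := M.cramer y with hz_def
  set w : ι → L := fun i => (if i = j then -M.det else 0) + ∑ c, (if e c = i then z c else 0)
    with hw_def
  have hej : ∀ c, e c ≠ j := fun c h => hj ⟨c, h⟩
  have hwj : w j = -M.det := by
    show ((if j = j then -M.det else 0) + ∑ c, if e c = j then z c else 0) = -M.det
    rw [if_pos rfl, Finset.sum_eq_zero (fun c _ => if_neg (hej c)), add_zero]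
  have hw0 : ∀ i, i ∉ Set.range e → i ≠ j → w i = 0 := fun i hi hij => by
    simp only [w, if_neg hij, zero_add]
    exact Finset.sum_eq_zero fun c _ => if_neg fun h => hi ⟨c, h⟩
  -- the kernel identity (Cramer)
  have hker : ∀ a, ∑ i, x a i * w i = 0 := fun a => by
    have h1 : ∑ i, x a i * w i = -M.det * y a + ∑ c, M a c * z c := by
      simp only [w, mul_add, Finset.sum_add_distrib, mul_ite, mul_zero, Finset.mul_sum]
      congr 1
      · rw [Finset.sum_ite_eq']; simp [y, mul_comm]
      · rw [Finset.sum_comm]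
        refine Finset.sum_congr rfl fun c _ => ?_
        rw [Finset.sum_ite_eq]; simp [M]
    have h2 : ∑ c, M a c * z c = (M *ᵥ z) a := by simp [Matrix.mulVec, dotProduct]
    rw [h1, h2, hz_def, Matrix.mulVec_cramer, Pi.smul_apply, smul_eq_mul]; ring
  -- rows are non-zero
  have hx0 : ∀ a, x a ≠ 0 := fun a ha => by
    have hrow : ∀ c, M a c = 0 := fun c => by simp [M, ha]
    exact (Matrix.det_eq_zero_of_row_eq_zero a hrow ▸ hM) |> fun h => not_isUnit_zero h
  refine ⟨w, by rw [hwj, neg_ne_zero]; exact hM.ne_zero, hw0, hker, ?_⟩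
  -- the tensor and the coefficient matrix
  set X : (α → ι) → L := fun k => ∏ a, x a (k a) with hX_def
  set cf : (α → ι) → (α → ι) → L := fun col k =>
    ∑ π : Equiv.Perm α, (if k = col ∘ π.symm then ((Equiv.Perm.sign π : ℤ) : L) else 0) with hcf_def
  set B : ι × (α → ι) → L := fun p =>
    (if p.1 = j then -cf e p.2 else 0) + ∑ c, (if e c = p.1 then cf (Function.update e c j) p.2 else 0)
    with hB_def
  have hdetM : M.det = ∑ k, cf e k * X k := det_colSelect_eq_sum x e
  have hz : ∀ c, z c = ∑ k, cf (Function.update e c j) k * X k := fun c => by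
    rw [hz_def, Matrix.cramer_apply, ← det_colSelect_eq_sum x (Function.update (⇑e) c j)]
    congr 1
    ext a c'
    simp only [Matrix.updateCol_apply, Matrix.of_apply, Function.update_apply, M, y]
    split_ifs <;> rfl
  have hwB : w = fun i => ∑ k, B (i, k) * X k := by
    funext i
    simp only [w, B, add_mul, Finset.sum_add_distrib, Finset.sum_mul, ite_mul, zero_mul, neg_mul]
    congr 1
    · split_ifs
      · rw [hdetM, ← Finset.sum_neg_distrib]
      · simp
    · rw [Finset.sum_comm]
      refine Finset.sum_congr rfl fun c _ => ?_
      split_ifs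
      · exact hz c
      · simp
  -- entries of `B` lie in `{0, ±1}`
  have hinj : ∀ c, Function.Injective (Function.update (⇑e) c j) := fun c a a' h => by
    simp only [Function.update_apply] at h
    split_ifs at h with h1 h2 h2
    · exact h1.trans h2.symm
    · exact absurd h.symm (hej a')
    · exact absurd h (hej a)
    · exact e.injective h
  have hBsign : ∀ p, B p = 0 ∨ B p = 1 ∨ B p = -1 := fun ⟨i, k⟩ => by
    simp only [B]
    by_cases hij : i = j
    · subst hij
      rw [if_pos rfl, Finset.sum_eq_zero (fun c _ => if_neg (hej c)), add_zero]
      rcases sum_perm_ite_sign (L := L) e.injective k with h | h | h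
      · left; rw [show cf e k = 0 from h, neg_zero]
      · right; right; rw [show cf e k = 1 from h]
      · right; left; rw [show cf e k = -1 from h, neg_neg]
    · rw [if_neg hij, zero_add]
      by_cases hi : ∃ c, e c = i
      · obtain ⟨c₀, hc₀⟩ := hi
        rw [Finset.sum_eq_single c₀ (fun c _ hne => if_neg fun h => hne (e.injective (h.trans hc₀.symm)))
          (fun h => absurd (Finset.mem_univ _) h), if_pos hc₀]
        exact sum_perm_ite_sign (hinj c₀) k
      · push Not at hi
        left; exact Finset.sum_eq_zero fun c _ => if_neg (hi c)
  -- heights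
  have hXh : Height.logHeight X = ∑ a, Height.logHeight (x a) := Height.logHeight_fun_prod_eq hx0
  have hBh : Height.logHeight B = 0 := logHeight_eq_zero_of_sign B hBsign
  have hlin := Height.logHeight_linearMap_apply_le B X
  have htw : (Height.totalWeight L : ℝ) = Module.finrank ℚ L := by
    exact_mod_cast NumberField.totalWeight_eq_finrank L
  have hcard : Real.log (Nat.card (α → ι)) = Fintype.card α * Real.log (Fintype.card ι) := by
    rw [Nat.card_eq_fintype_card, Fintype.card_fun, Nat.cast_pow, Real.log_pow]
  rw [hwB]
  calc Height.logHeight (fun i => ∑ k, B (i, k) * X k)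
      ≤ Height.totalWeight L * Real.log (Nat.card (α → ι)) + Height.logHeight B + Height.logHeight X :=
        hlin
    _ = ∑ a, Height.logHeight (x a) + Fintype.card α * Real.log (Fintype.card ι) * Module.finrank ℚ L := by
        rw [htw, hcard, hBh, hXh]; ring

namespace SatelliteHeightCramer

variable {L : Type} [Field L] [NumberField L]

/-! ## An invertible block of rows of a matrix with independent columns -/

/-- **Row rank = column rank**, in the form used: if the columns of `M : ρ × α` are linearly
independent, some `α` rows of `M` form an invertible square matrix. [folklore] -/
theorem exists_isUnit_submatrix {F : Type*} [Field F] {ρ α : Type*} [Fintype ρ] [Fintype α]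
    [DecidableEq α] (M : Matrix ρ α F) (hM : LinearIndependent F M.col) :
    ∃ g : α → ρ, IsUnit (M.submatrix g id) := by
  classical
  -- rank `M = #α`, also as the dimension of the row space
  have hrank : M.rank = Fintype.card α := by
    rw [Matrix.rank_eq_finrank_span_cols, finrank_span_eq_card hM]
  rw [Matrix.rank_eq_finrank_span_row] at hrank
  obtain ⟨b, hb, hspan, hli⟩ := exists_linearIndependent F (Set.range M.row)
  have hbfin : b.Finite := (Set.finite_range M.row).subset hb
  haveI : Fintype ↥b := hbfin.fintype
  have hcardb : Fintype.card ↥b = Fintype.card α := by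
    have h3 := finrank_span_eq_card (R := F) hli
    rw [Subtype.range_coe] at h3
    rw [← hrank, ← hspan, h3]
  set eb : α ≃ ↥b := (Fintype.equivOfCardEq hcardb).symm with heb
  have hpre : ∀ v : ↥b, ∃ r : ρ, M.row r = v := fun v => hb v.2
  choose g' hg' using hpre
  refine ⟨fun a => g' (eb a), ?_⟩
  rw [← Matrix.linearIndependent_rows_iff_isUnit]
  have hrow : (M.submatrix (fun a => g' (eb a)) id).row = (Subtype.val : ↥b → (α → F)) ∘ eb := by
    funext a
    simp only [Function.comp_apply, ← hg' (eb a)]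
    rfl
  rw [hrow]
  exact hli.comp _ eb.injective

/-! ## Heights of Veronese vectors -/

/-- `h_L((∏ᵢ xᵢ^{kᵢ})_{|k| = ν}) ≤ ν · h_L(x)`: the Veronese vector of degree `ν` is a sub-tuple
of the `ν`-fold tensor power of `x`, whose height is `ν h(x)`.
[cite: BombieriGubler2006, §1.5 (1.5.14)–(1.5.15) (p. 20)] -/
theorem logHeight_veronese_le {n : ℕ} (ν : ℕ) (x : Fin n → L) :
    Height.logHeight (fun k : ↥(Finset.Nat.antidiagonalTuple n ν) =>
      ∏ i, x i ^ (k : Fin n → ℕ) i) ≤ ν * Height.logHeight x := by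
  classical
  by_cases hx : x = 0
  · -- all entries are `0` (if `ν ≥ 1`) or the tuple is constant (if `ν = 0`)
    rcases Nat.eq_zero_or_pos ν with hν | hν
    · subst hν
      have hsub : Subsingleton ↥(Finset.Nat.antidiagonalTuple n 0) := ⟨fun k k' => by
        ext i
        have hk := Finset.Nat.mem_antidiagonalTuple.mp k.2
        have hk' := Finset.Nat.mem_antidiagonalTuple.mp k'.2
        have h1 : (k : Fin n → ℕ) i = 0 := by
          have := Finset.sum_eq_zero_iff.mp hk i (Finset.mem_univ _); exact this
        have h2 : (k' : Fin n → ℕ) i = 0 := by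
          have := Finset.sum_eq_zero_iff.mp hk' i (Finset.mem_univ _); exact this
        rw [h1, h2]⟩
      rw [Height.logHeight_eq_zero_of_subsingleton]
      simp
    · have h0 : (fun k : ↥(Finset.Nat.antidiagonalTuple n ν) => ∏ i, x i ^ (k : Fin n → ℕ) i) = 0 := by
        funext k
        have hk := Finset.Nat.mem_antidiagonalTuple.mp k.2
        obtain ⟨i, -, hi⟩ : ∃ i ∈ Finset.univ, (k : Fin n → ℕ) i ≠ 0 := by
          by_contra hall
          push Not at hall
          rw [Finset.sum_eq_zero hall] at hk
          omega
        rw [Pi.zero_apply]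
        exact Finset.prod_eq_zero (Finset.mem_univ i) (by rw [hx, Pi.zero_apply, zero_pow hi])
      rw [h0, Height.logHeight_zero]
      exact mul_nonneg (Nat.cast_nonneg _) (Height.logHeight_nonneg _)
  -- the tensor power
  set T : (Fin ν → Fin n) → L := fun f => ∏ l, x (f l) with hT
  have hTh : Height.logHeight T = ν * Height.logHeight x := by
    have h := Height.logHeight_fun_prod_eq (x := fun _ : Fin ν => x) (fun _ => hx)
    simp only [Finset.sum_const, Finset.card_univ, Fintype.card_fin, nsmul_eq_mul] at h
    exact h
  -- an enumeration of the multiset of each exponent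
  have hφ : ∀ k : ↥(Finset.Nat.antidiagonalTuple n ν), ∃ f : Fin ν → Fin n,
      ∏ l, x (f l) = ∏ i, x i ^ (k : Fin n → ℕ) i := by
    intro k
    have hk := Finset.Nat.mem_antidiagonalTuple.mp k.2
    set d : Fin n →₀ ℕ := Finsupp.equivFunOnFinite.symm (k : Fin n → ℕ) with hd
    set s : Multiset (Fin n) := Finsupp.toMultiset d with hs
    have hcard : s.toList.length = ν := by
      rw [Multiset.length_toList, hs, Finsupp.card_toMultiset, ← hk, Finsupp.sum_fintype _ _ (fun _ => rfl)]
      simp [d]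
    refine ⟨fun l => s.toList.get (Fin.cast hcard.symm l), ?_⟩
    have h1 : ∏ l : Fin ν, x (s.toList.get (Fin.cast hcard.symm l)) = (s.toList.map x).prod := by
      rw [← Fin.prod_univ_fun_getElem]
      exact Fintype.prod_equiv (finCongr hcard.symm) _ _ fun l => by simp [List.get_eq_getElem]
    have h2 : (s.toList.map x).prod = (s.map x).prod := Multiset.prod_map_toList s x
    have h3 : (s.map x).prod = ∏ i, x i ^ (k : Fin n → ℕ) i := by
      rw [hs, Finsupp.toMultiset_map, Finsupp.prod_toMultiset,
        Finsupp.prod_mapDomain_index (fun _ => pow_zero _) (fun _ _ _ => pow_add _ _ _),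
        Finsupp.prod_fintype _ _ (fun _ => pow_zero _)]
      simp [d]
    rw [h1, h2, h3]
  choose φ hφ using hφ
  have hcomp : (fun k : ↥(Finset.Nat.antidiagonalTuple n ν) => ∏ i, x i ^ (k : Fin n → ℕ) i) = T ∘ φ :=
    funext fun k => by simp only [Function.comp_apply, T, hφ k]
  rw [hcomp, ← hTh]
  exact Height.logHeight_comp_le φ T

end SatelliteHeightCramer

end Summit.Schanuel.Schanuel.Cruxes.ApproximationProperty.OrbitInterpolationDeterminant

end
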